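import Mathlib
import Literature.MathematicalPhysics.QuantumLattice.WilsonDiracAP
import Summits.QuantumFields.QCD.Theorems.QuarksAsStableActionWilsonQuarkStabilityTangentDelta
import Summits.QuantumFields.QCD.Theorems.QuarksAsStableActionCriticalLineDiamagnetismStubDeltaBounds
import Summits.QuantumFields.QCD.Theorems.QuarksAsStableActionCriticalLineDiamagnetismStubCellGainOfGauged

/-!
# Unitary links near `1`: the link field `E = X − 1`, its anti-Hermitian part, plaquette deficits
(helper for crux stmt-QuantumFields-9734, line `Sketch`, stub `stub_unitaryCellIneq`)

What.  On the `2⁴` block (`Edge 4 2`, `Plaquette 4 2`) let `X` be a `U(3)` link field all of whose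
link deficits `d_e = 3 − Re tr X_e` are `≤ η`, `E_e = X_e − 1` and `Y_e = ½ (E_e − E_eᴴ)`.  Then
(1) `‖E_e‖_F² = 2 d_e`; (2) Pythagoras `‖E_e‖_F² = ‖Y_e‖_F² + ‖E_e − Y_e‖_F²`;
(3) `‖E_e − Y_e‖_F² ≤ η d_e`; (4) `Σ_p (3 − Re tr X_p) ≤ Σ_p ‖curl Y_p‖_F² + 288 η Σ_e d_e`,
where `curl Y_p = Y(x,i) + Y(x+î,j) − Y(x+ĵ,i) − Y(x,j)` for the plaquette `p = (x; i < j)`.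

How.  (1) is the sibling's `sum_norm_sq_sub_one`.  (2) is the entrywise parallelogram law
(`UnitaryCellIneq.sum_norm_sq_split`).  (3): unitarity `(1 + E)ᴴ (1 + E) = 1` gives
`E + Eᴴ = −Eᴴ E`, so `E − Y = −½ Eᴴ E` (`herm_part_eq`), and Frobenius submultiplicativity
(`frob_mul_le`, Cauchy–Schwarz) gives `‖E − Y‖_F² ≤ ¼ ‖E‖_F⁴ = d_e² ≤ η d_e` (`herm_part_le`).
(4): for `p = (x; i < j)` put `W₁ = X(x,i)`, `W₂ = X(x+î,j)`, `W₃ = X(x+ĵ,i)`, `W₄ = X(x,j)`;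
then `2 (3 − Re tr W₁W₂W₃⁻¹W₄⁻¹) = ‖W₁W₂ − W₄W₃‖_F²` (`two_mul_deficit_holonomy`, unitary
invariance of the Frobenius sum), and `W₁W₂ − W₄W₃ = curl Y + ρ`,
`ρ = curl (E − Y) + E₁E₂ − E₄E₃` (`noncomm_ring`), so `3 − Re tr X_p ≤ ‖curl Y‖² + ‖ρ‖²` and
`‖ρ‖² ≤ 16 η (d₁ + d₂ + d₃ + d₄)` (`deficit_holonomy_le`, using (1), (3) and
`‖E₁E₂‖² ≤ 4 d₁ d₂ ≤ 2η(d₁ + d₂)`); finally `Σ_p (d₁ + d₂ + d₃ + d₄) ≤ 12 Σ_e d_e`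
(`sum_plaquette_links_le`: in a fixed plane `(i, j)` the four link sums are
`D_i + D_j + D_i + D_j ≤ 2 Σ_e d_e` after re-indexing the shifted sites, and there are six
planes), and `16 · 12 = 192 ≤ 288`.
Sources: folklore linear algebra (Frobenius norm, Cauchy–Schwarz); Wilson 1974 (plaquette
holonomy); patterns: siblings `…WilsonQuarkStabilityTangentDelta`, `…StubDeltaBounds`,
`…StubCellRegauge`.  Pure theorem file (no definitions).
-/

noncomputable section

open scoped BigOperators Classical Matrix ComplexConjugate
open Finset
open Literature.MathematicalPhysics.QuantumLattice Literature.MathematicalPhysics.QuantumFieldTheory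
  Literature.Probability.LatticeModels

namespace Summit.QuantumFields.QCD.Cruxes.CriticalLineDiamagnetism.ChessboardCellGain

open Summit.QuantumFields.QCD.Cruxes.WilsonQuarkStability.FreeTangentLandauChessboard

namespace UnitaryCellIneq

/-! ### Frobenius-sum inequalities on `3 × 3` complex matrices -/

/-- `‖M + N‖_F² ≤ 2‖M‖_F² + 2‖N‖_F²` (entrywise `‖s + r‖² ≤ (‖s‖ + ‖r‖)² ≤ 2‖s‖² + 2‖r‖²`). -/
theorem frob_add_le (M N : Matrix (Fin 3) (Fin 3) ℂ) :
    ∑ a, ∑ b, ‖(M + N) a b‖ ^ 2 ≤ 2 * (∑ a, ∑ b, ‖M a b‖ ^ 2) + 2 * ∑ a, ∑ b, ‖N a b‖ ^ 2 := by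
  simp only [Finset.mul_sum, ← Finset.sum_add_distrib, Matrix.add_apply]
  refine Finset.sum_le_sum fun a _ => Finset.sum_le_sum fun b _ => ?_
  have h1 : ‖M a b + N a b‖ ^ 2 ≤ (‖M a b‖ + ‖N a b‖) ^ 2 :=
    pow_le_pow_left₀ (norm_nonneg _) (norm_add_le _ _) 2
  nlinarith [sq_nonneg (‖M a b‖ - ‖N a b‖)]

/-- `‖M − N‖_F² ≤ 2‖M‖_F² + 2‖N‖_F²` (entrywise `‖s − r‖² ≤ (‖s‖ + ‖r‖)² ≤ 2‖s‖² + 2‖r‖²`). -/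
theorem frob_sub_le (M N : Matrix (Fin 3) (Fin 3) ℂ) :
    ∑ a, ∑ b, ‖(M - N) a b‖ ^ 2 ≤ 2 * (∑ a, ∑ b, ‖M a b‖ ^ 2) + 2 * ∑ a, ∑ b, ‖N a b‖ ^ 2 := by
  simp only [Finset.mul_sum, ← Finset.sum_add_distrib, Matrix.sub_apply]
  refine Finset.sum_le_sum fun a _ => Finset.sum_le_sum fun b _ => ?_
  have h1 : ‖M a b - N a b‖ ^ 2 ≤ (‖M a b‖ + ‖N a b‖) ^ 2 :=
    pow_le_pow_left₀ (norm_nonneg _) (norm_sub_le _ _) 2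
  nlinarith [sq_nonneg (‖M a b‖ - ‖N a b‖)]

/-- **Frobenius submultiplicativity** `‖A B‖_F² ≤ ‖A‖_F² ‖B‖_F²` (Cauchy–Schwarz, row times
column). -/
theorem frob_mul_le (A B : Matrix (Fin 3) (Fin 3) ℂ) :
    ∑ a, ∑ b, ‖(A * B) a b‖ ^ 2 ≤ (∑ a, ∑ b, ‖A a b‖ ^ 2) * ∑ a, ∑ b, ‖B a b‖ ^ 2 := by
  have h : ∀ a b, ‖(A * B) a b‖ ^ 2 ≤ (∑ c, ‖A a c‖ ^ 2) * ∑ c, ‖B c b‖ ^ 2 := fun a b => by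
    have h1 : ‖(A * B) a b‖ ≤ ∑ c, ‖A a c‖ * ‖B c b‖ := by
      rw [Matrix.mul_apply]
      exact (norm_sum_le _ _).trans (le_of_eq (Finset.sum_congr rfl fun c _ => norm_mul _ _))
    calc ‖(A * B) a b‖ ^ 2 ≤ (∑ c, ‖A a c‖ * ‖B c b‖) ^ 2 := pow_le_pow_left₀ (norm_nonneg _) h1 2
      _ ≤ (∑ c, ‖A a c‖ ^ 2) * ∑ c, ‖B c b‖ ^ 2 := Finset.sum_mul_sq_le_sq_mul_sq _ _ _
  calc ∑ a, ∑ b, ‖(A * B) a b‖ ^ 2 ≤ ∑ a, ∑ b, (∑ c, ‖A a c‖ ^ 2) * ∑ c, ‖B c b‖ ^ 2 :=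
        Finset.sum_le_sum fun a _ => Finset.sum_le_sum fun b _ => h a b
    _ = (∑ a, ∑ b, ‖A a b‖ ^ 2) * ∑ a, ∑ b, ‖B a b‖ ^ 2 := by
        have hB : ∑ b, ∑ c, ‖B c b‖ ^ 2 = ∑ a, ∑ b, ‖B a b‖ ^ 2 := Finset.sum_comm
        rw [Finset.sum_mul]
        refine Finset.sum_congr rfl fun a _ => ?_
        rw [← Finset.mul_sum, hB]

/-- Right multiplication by a unitary preserves the Frobenius sum. -/
theorem sum_norm_sq_mul_unitary (M : Matrix (Fin 3) (Fin 3) ℂ) (u : Matrix.unitaryGroup (Fin 3) ℂ) :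
    ∑ a, ∑ b, ‖(M * (u : Matrix (Fin 3) (Fin 3) ℂ)) a b‖ ^ 2 = ∑ a, ∑ b, ‖M a b‖ ^ 2 := by
  have h : M * (u : Matrix (Fin 3) (Fin 3) ℂ) =
      star (((u⁻¹ : Matrix.unitaryGroup (Fin 3) ℂ) : Matrix (Fin 3) (Fin 3) ℂ) * star M) := by
    rw [star_mul, star_star, Matrix.UnitaryGroup.inv_val, star_star]
  rw [h, StubDeltaBounds.sum_norm_sq_star, StubDeltaBounds.sum_norm_sq_unitary_mul,
    StubDeltaBounds.sum_norm_sq_star]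

/-! ### The Hermitian / anti-Hermitian splitting of `E = g − 1` -/

/-- **Pythagoras for the Hermitian/anti-Hermitian splitting** (entrywise parallelogram law):
`‖E‖_F² = ‖½(E − Eᴴ)‖_F² + ‖E − ½(E − Eᴴ)‖_F²`. -/
theorem sum_norm_sq_split (E : Matrix (Fin 3) (Fin 3) ℂ) :
    ∑ a, ∑ b, ‖E a b‖ ^ 2 =
      (∑ a, ∑ b, ‖((1 / 2 : ℂ) • (E - Eᴴ)) a b‖ ^ 2) +
        ∑ a, ∑ b, ‖(E - (1 / 2 : ℂ) • (E - Eᴴ)) a b‖ ^ 2 := by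
  have h12 : (1 / 2 : ℂ) = ((1 / 2 : ℝ) : ℂ) := by push_cast; rfl
  have key : ∀ a b, ‖((1 / 2 : ℂ) • (E - Eᴴ)) a b‖ ^ 2 + ‖(E - (1 / 2 : ℂ) • (E - Eᴴ)) a b‖ ^ 2 =
      1 / 2 * ‖E a b‖ ^ 2 + 1 / 2 * ‖E b a‖ ^ 2 := by
    intro a b
    have h1 : ((1 / 2 : ℂ) • (E - Eᴴ)) a b = ((1 / 2 : ℝ) : ℂ) * (E a b - star (E b a)) := by
      simp only [Matrix.smul_apply, Matrix.sub_apply, Matrix.conjTranspose_apply, smul_eq_mul, h12]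
    have h2 : (E - (1 / 2 : ℂ) • (E - Eᴴ)) a b = ((1 / 2 : ℝ) : ℂ) * (E a b + star (E b a)) := by
      simp only [Matrix.smul_apply, Matrix.sub_apply, Matrix.conjTranspose_apply, smul_eq_mul, h12]
      push_cast
      ring
    rw [h1, h2]
    simp only [Complex.sq_norm, Complex.normSq_apply, Complex.re_ofReal_mul, Complex.im_ofReal_mul,
      Complex.add_re, Complex.add_im, Complex.sub_re, Complex.sub_im, Complex.star_def,
      Complex.conj_re, Complex.conj_im]
    ring
  have hsum : (∑ a, ∑ b, ‖((1 / 2 : ℂ) • (E - Eᴴ)) a b‖ ^ 2) +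
      ∑ a, ∑ b, ‖(E - (1 / 2 : ℂ) • (E - Eᴴ)) a b‖ ^ 2 =
      1 / 2 * ∑ a, ∑ b, ‖E a b‖ ^ 2 + 1 / 2 * ∑ a, ∑ b, ‖E b a‖ ^ 2 := by
    rw [← Finset.sum_add_distrib, Finset.mul_sum, Finset.mul_sum, ← Finset.sum_add_distrib]
    refine Finset.sum_congr rfl fun a _ => ?_
    rw [← Finset.sum_add_distrib, Finset.mul_sum, Finset.mul_sum, ← Finset.sum_add_distrib]
    exact Finset.sum_congr rfl fun b _ => key a b
  have hS : ∑ a, ∑ b, ‖E b a‖ ^ 2 = ∑ a, ∑ b, ‖E a b‖ ^ 2 := Finset.sum_comm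
  rw [hsum, hS]
  ring

/-- Unitarity `gᴴ g = 1` makes the Hermitian part of `E = g − 1` quadratic in `E`:
`E − ½(E − Eᴴ) = −½ Eᴴ E`. -/
theorem herm_part_eq (g : Matrix.unitaryGroup (Fin 3) ℂ) :
    ((g : Matrix (Fin 3) (Fin 3) ℂ) - 1) -
        (1 / 2 : ℂ) • (((g : Matrix (Fin 3) (Fin 3) ℂ) - 1) -
          ((g : Matrix (Fin 3) (Fin 3) ℂ) - 1)ᴴ) =
      -(1 / 2 : ℂ) •
        (((g : Matrix (Fin 3) (Fin 3) ℂ) - 1)ᴴ * ((g : Matrix (Fin 3) (Fin 3) ℂ) - 1)) := by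
  have hg : (g : Matrix (Fin 3) (Fin 3) ℂ)ᴴ * (g : Matrix (Fin 3) (Fin 3) ℂ) = 1 :=
    Matrix.UnitaryGroup.star_mul_self g
  have hE : ((g : Matrix (Fin 3) (Fin 3) ℂ) - 1)ᴴ * ((g : Matrix (Fin 3) (Fin 3) ℂ) - 1) =
      -(((g : Matrix (Fin 3) (Fin 3) ℂ) - 1) + ((g : Matrix (Fin 3) (Fin 3) ℂ) - 1)ᴴ) := by
    simp only [Matrix.conjTranspose_sub, Matrix.conjTranspose_one, Matrix.sub_mul, Matrix.mul_sub,
      Matrix.one_mul, Matrix.mul_one, hg]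
    abel
  rw [hE, smul_neg, neg_smul, neg_neg, smul_add]
  module

/-- **The Hermitian part is small**: `‖E − ½(E − Eᴴ)‖_F² ≤ (3 − Re tr g)²` for unitary `g`,
`E = g − 1` (from `herm_part_eq`, `frob_mul_le` and `‖E‖_F² = 2 (3 − Re tr g)`). -/
theorem herm_part_le (g : Matrix.unitaryGroup (Fin 3) ℂ) :
    ∑ a, ∑ b, ‖(((g : Matrix (Fin 3) (Fin 3) ℂ) - 1) -
        (1 / 2 : ℂ) • (((g : Matrix (Fin 3) (Fin 3) ℂ) - 1) -
          ((g : Matrix (Fin 3) (Fin 3) ℂ) - 1)ᴴ) : Matrix (Fin 3) (Fin 3) ℂ) a b‖ ^ 2 ≤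
      (3 - ((g : Matrix (Fin 3) (Fin 3) ℂ)).trace.re) ^ 2 := by
  rw [herm_part_eq]
  set E : Matrix (Fin 3) (Fin 3) ℂ := (g : Matrix (Fin 3) (Fin 3) ℂ) - 1 with hE
  have hEE : ∑ a, ∑ b, ‖E a b‖ ^ 2 = 2 * (3 - ((g : Matrix (Fin 3) (Fin 3) ℂ)).trace.re) :=
    sum_norm_sq_sub_one g
  have hstar : ∑ a, ∑ b, ‖Eᴴ a b‖ ^ 2 = ∑ a, ∑ b, ‖E a b‖ ^ 2 := by
    rw [← Matrix.star_eq_conjTranspose]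
    exact StubDeltaBounds.sum_norm_sq_star E
  have hsmul : ∀ a b, ‖(-(1 / 2 : ℂ) • (Eᴴ * E)) a b‖ ^ 2 = 1 / 4 * ‖(Eᴴ * E) a b‖ ^ 2 := by
    intro a b
    rw [Matrix.smul_apply, smul_eq_mul, norm_mul, norm_neg, mul_pow]
    norm_num
  simp only [hsmul, ← Finset.mul_sum]
  calc 1 / 4 * ∑ a, ∑ b, ‖(Eᴴ * E) a b‖ ^ 2
      ≤ 1 / 4 * ((∑ a, ∑ b, ‖Eᴴ a b‖ ^ 2) * ∑ a, ∑ b, ‖E a b‖ ^ 2) := by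
        gcongr
        exact frob_mul_le _ _
    _ = (3 - ((g : Matrix (Fin 3) (Fin 3) ℂ)).trace.re) ^ 2 := by
        rw [hstar, hEE]
        ring

/-! ### Plaquettes -/

/-- **Plaquette deficit as a Frobenius norm**:
`2 (3 − Re tr (W₁ W₂ W₃⁻¹ W₄⁻¹)) = ‖W₁ W₂ − W₄ W₃‖_F²` for unitary `Wₖ`
(`‖g − 1‖_F² = 2 (3 − Re tr g)` for `g = W₁W₂W₃⁻¹W₄⁻¹` and right unitary invariance). -/
theorem two_mul_deficit_holonomy (W₁ W₂ W₃ W₄ : Matrix.unitaryGroup (Fin 3) ℂ) :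
    2 * (3 - ((W₁ * W₂ * W₃⁻¹ * W₄⁻¹ : Matrix.unitaryGroup (Fin 3) ℂ) :
        Matrix (Fin 3) (Fin 3) ℂ).trace.re) =
      ∑ a, ∑ b, ‖((W₁ : Matrix (Fin 3) (Fin 3) ℂ) * (W₂ : Matrix (Fin 3) (Fin 3) ℂ) -
        (W₄ : Matrix (Fin 3) (Fin 3) ℂ) * (W₃ : Matrix (Fin 3) (Fin 3) ℂ)) a b‖ ^ 2 := by
  rw [← sum_norm_sq_sub_one (W₁ * W₂ * W₃⁻¹ * W₄⁻¹), ← sum_norm_sq_mul_unitary _ (W₄ * W₃)]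
  have h3 : star (W₃ : Matrix (Fin 3) (Fin 3) ℂ) * (W₃ : Matrix (Fin 3) (Fin 3) ℂ) = 1 :=
    Matrix.UnitaryGroup.star_mul_self W₃
  have h4 : star (W₄ : Matrix (Fin 3) (Fin 3) ℂ) * (W₄ : Matrix (Fin 3) (Fin 3) ℂ) = 1 :=
    Matrix.UnitaryGroup.star_mul_self W₄
  have h : (((W₁ * W₂ * W₃⁻¹ * W₄⁻¹ : Matrix.unitaryGroup (Fin 3) ℂ) :
      Matrix (Fin 3) (Fin 3) ℂ) - 1) *
      ((W₄ * W₃ : Matrix.unitaryGroup (Fin 3) ℂ) : Matrix (Fin 3) (Fin 3) ℂ) =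
      (W₁ : Matrix (Fin 3) (Fin 3) ℂ) * (W₂ : Matrix (Fin 3) (Fin 3) ℂ) -
        (W₄ : Matrix (Fin 3) (Fin 3) ℂ) * (W₃ : Matrix (Fin 3) (Fin 3) ℂ) := by
    simp only [Matrix.UnitaryGroup.mul_val, Matrix.UnitaryGroup.inv_val]
    rw [Matrix.sub_mul, Matrix.one_mul]
    have e : (W₁ : Matrix (Fin 3) (Fin 3) ℂ) * (W₂ : Matrix (Fin 3) (Fin 3) ℂ) *
        star (W₃ : Matrix (Fin 3) (Fin 3) ℂ) * star (W₄ : Matrix (Fin 3) (Fin 3) ℂ) *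
          ((W₄ : Matrix (Fin 3) (Fin 3) ℂ) * (W₃ : Matrix (Fin 3) (Fin 3) ℂ)) =
        (W₁ : Matrix (Fin 3) (Fin 3) ℂ) * (W₂ : Matrix (Fin 3) (Fin 3) ℂ) :=
      calc _ = (W₁ : Matrix (Fin 3) (Fin 3) ℂ) * (W₂ : Matrix (Fin 3) (Fin 3) ℂ) *
            (star (W₃ : Matrix (Fin 3) (Fin 3) ℂ) * ((star (W₄ : Matrix (Fin 3) (Fin 3) ℂ) *
              (W₄ : Matrix (Fin 3) (Fin 3) ℂ)) * (W₃ : Matrix (Fin 3) (Fin 3) ℂ))) := by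
            simp only [Matrix.mul_assoc]
        _ = (W₁ : Matrix (Fin 3) (Fin 3) ℂ) * (W₂ : Matrix (Fin 3) (Fin 3) ℂ) := by
            rw [h4, Matrix.one_mul, h3, Matrix.mul_one]
    rw [e]
  rw [h]

/-- **Linearised plaquette deficit.**  For unitary `W₁, …, W₄` with deficits
`dₖ = 3 − Re tr Wₖ ≤ η`, `Eₖ = Wₖ − 1` and `Yₖ = ½(Eₖ − Eₖᴴ)`:
`3 − Re tr (W₁W₂W₃⁻¹W₄⁻¹) ≤ ‖Y₁ + Y₂ − Y₃ − Y₄‖_F² + 16 η (d₁ + d₂ + d₃ + d₄)`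
(`W₁W₂ − W₄W₃ = curl Y + ρ`, `ρ = curl (E − Y) + E₁E₂ − E₄E₃`,
`‖E₁E₂‖_F² ≤ 4 d₁ d₂ ≤ 2η(d₁ + d₂)`). -/
theorem deficit_holonomy_le {η : ℝ} (W₁ W₂ W₃ W₄ : Matrix.unitaryGroup (Fin 3) ℂ)
    (Y₁ Y₂ Y₃ Y₄ : Matrix (Fin 3) (Fin 3) ℂ)
    (hY₁ : Y₁ = (1 / 2 : ℂ) • (((W₁ : Matrix (Fin 3) (Fin 3) ℂ) - 1) -
      ((W₁ : Matrix (Fin 3) (Fin 3) ℂ) - 1)ᴴ))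
    (hY₂ : Y₂ = (1 / 2 : ℂ) • (((W₂ : Matrix (Fin 3) (Fin 3) ℂ) - 1) -
      ((W₂ : Matrix (Fin 3) (Fin 3) ℂ) - 1)ᴴ))
    (hY₃ : Y₃ = (1 / 2 : ℂ) • (((W₃ : Matrix (Fin 3) (Fin 3) ℂ) - 1) -
      ((W₃ : Matrix (Fin 3) (Fin 3) ℂ) - 1)ᴴ))
    (hY₄ : Y₄ = (1 / 2 : ℂ) • (((W₄ : Matrix (Fin 3) (Fin 3) ℂ) - 1) -
      ((W₄ : Matrix (Fin 3) (Fin 3) ℂ) - 1)ᴴ))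
    (h₁ : 3 - ((W₁ : Matrix (Fin 3) (Fin 3) ℂ)).trace.re ≤ η)
    (h₂ : 3 - ((W₂ : Matrix (Fin 3) (Fin 3) ℂ)).trace.re ≤ η)
    (h₃ : 3 - ((W₃ : Matrix (Fin 3) (Fin 3) ℂ)).trace.re ≤ η)
    (h₄ : 3 - ((W₄ : Matrix (Fin 3) (Fin 3) ℂ)).trace.re ≤ η) :
    3 - ((W₁ * W₂ * W₃⁻¹ * W₄⁻¹ : Matrix.unitaryGroup (Fin 3) ℂ) :
        Matrix (Fin 3) (Fin 3) ℂ).trace.re ≤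
      (∑ a, ∑ b, ‖(Y₁ + Y₂ - Y₃ - Y₄) a b‖ ^ 2) +
        16 * η * ((3 - ((W₁ : Matrix (Fin 3) (Fin 3) ℂ)).trace.re) +
          (3 - ((W₂ : Matrix (Fin 3) (Fin 3) ℂ)).trace.re) +
          (3 - ((W₃ : Matrix (Fin 3) (Fin 3) ℂ)).trace.re) +
          (3 - ((W₄ : Matrix (Fin 3) (Fin 3) ℂ)).trace.re)) := by
  have hid := two_mul_deficit_holonomy W₁ W₂ W₃ W₄
  set d₁ : ℝ := 3 - ((W₁ : Matrix (Fin 3) (Fin 3) ℂ)).trace.re with hd₁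
  set d₂ : ℝ := 3 - ((W₂ : Matrix (Fin 3) (Fin 3) ℂ)).trace.re with hd₂
  set d₃ : ℝ := 3 - ((W₃ : Matrix (Fin 3) (Fin 3) ℂ)).trace.re with hd₃
  set d₄ : ℝ := 3 - ((W₄ : Matrix (Fin 3) (Fin 3) ℂ)).trace.re with hd₄
  set E₁ : Matrix (Fin 3) (Fin 3) ℂ := (W₁ : Matrix (Fin 3) (Fin 3) ℂ) - 1 with hE₁
  set E₂ : Matrix (Fin 3) (Fin 3) ℂ := (W₂ : Matrix (Fin 3) (Fin 3) ℂ) - 1 with hE₂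
  set E₃ : Matrix (Fin 3) (Fin 3) ℂ := (W₃ : Matrix (Fin 3) (Fin 3) ℂ) - 1 with hE₃
  set E₄ : Matrix (Fin 3) (Fin 3) ℂ := (W₄ : Matrix (Fin 3) (Fin 3) ℂ) - 1 with hE₄
  have hd₁0 : 0 ≤ d₁ := CellGainOfGauged.deficit_nonneg W₁
  have hd₂0 : 0 ≤ d₂ := CellGainOfGauged.deficit_nonneg W₂
  have hd₃0 : 0 ≤ d₃ := CellGainOfGauged.deficit_nonneg W₃
  have hd₄0 : 0 ≤ d₄ := CellGainOfGauged.deficit_nonneg W₄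
  have hEE₁ : ∑ a, ∑ b, ‖E₁ a b‖ ^ 2 = 2 * d₁ := sum_norm_sq_sub_one W₁
  have hEE₂ : ∑ a, ∑ b, ‖E₂ a b‖ ^ 2 = 2 * d₂ := sum_norm_sq_sub_one W₂
  have hEE₃ : ∑ a, ∑ b, ‖E₃ a b‖ ^ 2 = 2 * d₃ := sum_norm_sq_sub_one W₃
  have hEE₄ : ∑ a, ∑ b, ‖E₄ a b‖ ^ 2 = 2 * d₄ := sum_norm_sq_sub_one W₄
  have hH₁ : ∑ a, ∑ b, ‖(E₁ - Y₁) a b‖ ^ 2 ≤ η * d₁ := by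
    rw [hY₁]
    exact (herm_part_le W₁).trans (by rw [sq]; exact mul_le_mul_of_nonneg_right h₁ hd₁0)
  have hH₂ : ∑ a, ∑ b, ‖(E₂ - Y₂) a b‖ ^ 2 ≤ η * d₂ := by
    rw [hY₂]
    exact (herm_part_le W₂).trans (by rw [sq]; exact mul_le_mul_of_nonneg_right h₂ hd₂0)
  have hH₃ : ∑ a, ∑ b, ‖(E₃ - Y₃) a b‖ ^ 2 ≤ η * d₃ := by
    rw [hY₃]
    exact (herm_part_le W₃).trans (by rw [sq]; exact mul_le_mul_of_nonneg_right h₃ hd₃0)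
  have hH₄ : ∑ a, ∑ b, ‖(E₄ - Y₄) a b‖ ^ 2 ≤ η * d₄ := by
    rw [hY₄]
    exact (herm_part_le W₄).trans (by rw [sq]; exact mul_le_mul_of_nonneg_right h₄ hd₄0)
  have hP : ∑ a, ∑ b, ‖(E₁ * E₂) a b‖ ^ 2 ≤ 2 * d₁ * (2 * d₂) :=
    (frob_mul_le E₁ E₂).trans_eq (by rw [hEE₁, hEE₂])
  have hQ : ∑ a, ∑ b, ‖(E₄ * E₃) a b‖ ^ 2 ≤ 2 * d₄ * (2 * d₃) :=
    (frob_mul_le E₄ E₃).trans_eq (by rw [hEE₄, hEE₃])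
  have h12 : d₁ * d₂ ≤ d₁ * η := mul_le_mul_of_nonneg_left h₂ hd₁0
  have h21 : d₁ * d₂ ≤ η * d₂ := mul_le_mul_of_nonneg_right h₁ hd₂0
  have h43 : d₄ * d₃ ≤ d₄ * η := mul_le_mul_of_nonneg_left h₃ hd₄0
  have h34 : d₄ * d₃ ≤ η * d₃ := mul_le_mul_of_nonneg_right h₄ hd₃0
  -- the decomposition `W₁W₂ − W₄W₃ = curl Y + ρ`
  have hdec : (W₁ : Matrix (Fin 3) (Fin 3) ℂ) * (W₂ : Matrix (Fin 3) (Fin 3) ℂ) -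
      (W₄ : Matrix (Fin 3) (Fin 3) ℂ) * (W₃ : Matrix (Fin 3) (Fin 3) ℂ) =
      (Y₁ + Y₂ - Y₃ - Y₄) +
        (((E₁ - Y₁) + (E₂ - Y₂) - ((E₃ - Y₃) + (E₄ - Y₄))) + (E₁ * E₂ - E₄ * E₃)) := by
    rw [hE₁, hE₂, hE₃, hE₄]
    noncomm_ring
  rw [hdec] at hid
  have hS := frob_add_le (Y₁ + Y₂ - Y₃ - Y₄)
    (((E₁ - Y₁) + (E₂ - Y₂) - ((E₃ - Y₃) + (E₄ - Y₄))) + (E₁ * E₂ - E₄ * E₃))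
  have hρ := frob_add_le ((E₁ - Y₁) + (E₂ - Y₂) - ((E₃ - Y₃) + (E₄ - Y₄))) (E₁ * E₂ - E₄ * E₃)
  have hc := frob_sub_le ((E₁ - Y₁) + (E₂ - Y₂)) ((E₃ - Y₃) + (E₄ - Y₄))
  have hc₁ := frob_add_le (E₁ - Y₁) (E₂ - Y₂)
  have hc₂ := frob_add_le (E₃ - Y₃) (E₄ - Y₄)
  have hpq := frob_sub_le (E₁ * E₂) (E₄ * E₃)
  linarith

/-- **Plaquette–link incidence on the `2⁴` block**: for `d ≥ 0` on edges,
`Σ_p (d(x,i) + d(x+î,j) + d(x+ĵ,i) + d(x,j)) ≤ 12 Σ_e d_e` (in a fixed plane `i < j` the four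
site sums are `D_i + D_j + D_i + D_j ≤ 2 Σ_e d_e` after re-indexing the shifted sites; there are
six planes). -/
theorem sum_plaquette_links_le (d : Edge 4 2 → ℝ) (hd : ∀ e, 0 ≤ d e) :
    ∑ p : Plaquette 4 2, (d (p.1, p.2.1.1) + d (Site.shift p.1 p.2.1.1, p.2.1.2) +
        d (Site.shift p.1 p.2.1.2, p.2.1.1) + d (p.1, p.2.1.2)) ≤ 12 * ∑ e, d e := by
  have hD : ∀ μ ν : Fin 4, μ ≠ ν →
      (∑ x : Site 4 2, d (x, μ)) + ∑ x : Site 4 2, d (x, ν) ≤ ∑ e, d e := by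
    intro μ ν hμν
    rw [Fintype.sum_prod_type, ← Finset.sum_add_distrib]
    refine Finset.sum_le_sum fun x _ => ?_
    have hsub : ∑ κ ∈ ({μ, ν} : Finset (Fin 4)), d (x, κ) ≤ ∑ κ, d (x, κ) :=
      Finset.sum_le_sum_of_subset_of_nonneg (Finset.subset_univ _) fun κ _ _ => hd _
    rwa [Finset.sum_pair hμν] at hsub
  have hshift : ∀ μ ν : Fin 4,
      ∑ x : Site 4 2, d (Site.shift x μ, ν) = ∑ x : Site 4 2, d (x, ν) := fun μ ν =>
    Fintype.sum_equiv (Equiv.addRight (Pi.single μ (1 : ZMod 2))) _ _ fun x => rfl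
  have hcard : Fintype.card {q : Fin 4 × Fin 4 // q.1 < q.2} = 6 := by decide
  calc ∑ p : Plaquette 4 2, (d (p.1, p.2.1.1) + d (Site.shift p.1 p.2.1.1, p.2.1.2) +
          d (Site.shift p.1 p.2.1.2, p.2.1.1) + d (p.1, p.2.1.2))
      = ∑ x : Site 4 2, ∑ s : {q : Fin 4 × Fin 4 // q.1 < q.2},
          (d (x, s.1.1) + d (Site.shift x s.1.1, s.1.2) + d (Site.shift x s.1.2, s.1.1) +
            d (x, s.1.2)) := Fintype.sum_prod_type _
    _ = ∑ s : {q : Fin 4 × Fin 4 // q.1 < q.2}, ∑ x : Site 4 2,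
          (d (x, s.1.1) + d (Site.shift x s.1.1, s.1.2) + d (Site.shift x s.1.2, s.1.1) +
            d (x, s.1.2)) := Finset.sum_comm
    _ ≤ ∑ _s : {q : Fin 4 × Fin 4 // q.1 < q.2}, 2 * ∑ e, d e := by
        refine Finset.sum_le_sum fun s _ => ?_
        simp only [Finset.sum_add_distrib, hshift]
        linarith [hD s.1.1 s.1.2 (ne_of_lt s.2)]
    _ = 12 * ∑ e, d e := by
        rw [Finset.sum_const, Finset.card_univ, hcard, nsmul_eq_mul]
        push_cast
        ring

end UnitaryCellIneq

/-- **Stub U — `unitaryCellIneq`** (crux stmt-QuantumFields-9734, line `Sketch`).  For a `U(3)`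
link field `X` on the `2⁴` block with link deficits `d_e = 3 − Re tr X_e ≤ η`, `E = X − 1`,
`Y = ½(E − Eᴴ)`: `‖E_e‖_F² = 2 d_e`; `‖E_e‖² = ‖Y_e‖² + ‖E_e − Y_e‖²`; `‖E_e − Y_e‖² ≤ η d_e`;
and `Σ_p (3 − Re tr X_p) ≤ Σ_p ‖curl Y_p‖_F² + 288 η Σ_e d_e`.  Assembled from
`UnitaryCellIneq.sum_norm_sq_split`, `herm_part_le`, `deficit_holonomy_le` (pointwise, constant
`16`) and `sum_plaquette_links_le` (`× 12`); `16 · 12 ≤ 288`. -/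
theorem stub_unitaryCellIneq : ∀ (X : GaugeConfig 4 2 (Matrix.unitaryGroup (Fin 3) ℂ)) (η : ℝ), (∀ e : Edge 4 2, (3 - ((X e : Matrix.unitaryGroup (Fin 3) ℂ) : Matrix (Fin 3) (Fin 3) ℂ).trace.re) ≤ η) → let E : Edge 4 2 → Matrix (Fin 3) (Fin 3) ℂ := fun e => ((X e : Matrix.unitaryGroup (Fin 3) ℂ) : Matrix (Fin 3) (Fin 3) ℂ) - 1; let Y : Edge 4 2 → Matrix (Fin 3) (Fin 3) ℂ := fun e => (1 / 2 : ℂ) • (E e - (E e)ᴴ); (∀ e : Edge 4 2, ∑ a, ∑ b, ‖E e a b‖ ^ 2 = 2 * (3 - ((X e : Matrix.unitaryGroup (Fin 3) ℂ) : Matrix (Fin 3) (Fin 3) ℂ).trace.re)) ∧ (∀ e : Edge 4 2, ∑ a, ∑ b, ‖E e a b‖ ^ 2 = (∑ a, ∑ b, ‖Y e a b‖ ^ 2) + ∑ a, ∑ b, ‖(E e - Y e) a b‖ ^ 2) ∧ (∀ e : Edge 4 2, ∑ a, ∑ b, ‖(E e - Y e) a b‖ ^ 2 ≤ η * (3 -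 ((X e : Matrix.unitaryGroup (Fin 3) ℂ) : Matrix (Fin 3) (Fin 3) ℂ).trace.re)) ∧ ∑ p : Plaquette 4 2, (3 - (unitaryFundamentalRep (Fin 3) ℂ (plaquetteHolonomy X p.1 p.2.1.1 p.2.1.2)).trace.re) ≤ (∑ p : Plaquette 4 2, ∑ a, ∑ b, ‖(Y (p.1, p.2.1.1) + Y (Site.shift p.1 p.2.1.1, p.2.1.2) - Y (Site.shift p.1 p.2.1.2, p.2.1.1) - Y (p.1, p.2.1.2)) a b‖ ^ 2) + 288 * η * ∑ e : Edge 4 2, (3 - ((X e : Matrix.unitaryGroup (Fin 3) ℂ) : Matrix (Fin 3) (Fin 3) ℂ).trace.re) := by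
  intro X η hη E Y
  have hd0 : ∀ e : Edge 4 2,
      0 ≤ 3 - ((X e : Matrix.unitaryGroup (Fin 3) ℂ) : Matrix (Fin 3) (Fin 3) ℂ).trace.re :=
    fun e => CellGainOfGauged.deficit_nonneg (X e)
  have hη0 : 0 ≤ η := (hd0 default).trans (hη default)
  refine ⟨fun e => sum_norm_sq_sub_one (X e), fun e => UnitaryCellIneq.sum_norm_sq_split (E e),
    fun e => ?_, ?_⟩
  · exact (UnitaryCellIneq.herm_part_le (X e)).trans
      (by rw [sq]; exact mul_le_mul_of_nonneg_right (hη e) (hd0 e))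
  · have hpt : ∀ p : Plaquette 4 2,
        3 - (unitaryFundamentalRep (Fin 3) ℂ (plaquetteHolonomy X p.1 p.2.1.1 p.2.1.2)).trace.re ≤
          (∑ a, ∑ b, ‖(Y (p.1, p.2.1.1) + Y (Site.shift p.1 p.2.1.1, p.2.1.2) -
              Y (Site.shift p.1 p.2.1.2, p.2.1.1) - Y (p.1, p.2.1.2)) a b‖ ^ 2) +
            16 * η * ((3 - ((X (p.1, p.2.1.1) : Matrix.unitaryGroup (Fin 3) ℂ) :
                Matrix (Fin 3) (Fin 3) ℂ).trace.re) +
              (3 - ((X (Site.shift p.1 p.2.1.1, p.2.1.2) : Matrix.unitaryGroup (Fin 3) ℂ) :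
                Matrix (Fin 3) (Fin 3) ℂ).trace.re) +
              (3 - ((X (Site.shift p.1 p.2.1.2, p.2.1.1) : Matrix.unitaryGroup (Fin 3) ℂ) :
                Matrix (Fin 3) (Fin 3) ℂ).trace.re) +
              (3 - ((X (p.1, p.2.1.2) : Matrix.unitaryGroup (Fin 3) ℂ) :
                Matrix (Fin 3) (Fin 3) ℂ).trace.re)) := fun p =>
      UnitaryCellIneq.deficit_holonomy_le (X (p.1, p.2.1.1)) (X (Site.shift p.1 p.2.1.1, p.2.1.2))
        (X (Site.shift p.1 p.2.1.2, p.2.1.1)) (X (p.1, p.2.1.2)) _ _ _ _ rfl rfl rfl rfl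
        (hη _) (hη _) (hη _) (hη _)
    have hlinks := UnitaryCellIneq.sum_plaquette_links_le
      (fun e : Edge 4 2 => 3 - ((X e : Matrix.unitaryGroup (Fin 3) ℂ) :
        Matrix (Fin 3) (Fin 3) ℂ).trace.re) hd0
    have hsum0 : 0 ≤ ∑ e : Edge 4 2,
        (3 - ((X e : Matrix.unitaryGroup (Fin 3) ℂ) : Matrix (Fin 3) (Fin 3) ℂ).trace.re) :=
      Finset.sum_nonneg fun e _ => hd0 e
    have h1 := Finset.sum_le_sum fun p (_ : p ∈ (Finset.univ : Finset (Plaquette 4 2))) => hpt p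
    rw [Finset.sum_add_distrib, ← Finset.mul_sum] at h1
    have h2 := mul_le_mul_of_nonneg_left hlinks (mul_nonneg (by norm_num : (0 : ℝ) ≤ 16) hη0)
    have h3 := mul_nonneg hη0 hsum0
    linarith

end Summit.QuantumFields.QCD.Cruxes.CriticalLineDiamagnetism.ChessboardCellGain

end
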